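/-
Copyright (c) 2026 the pub-hodgecm-mathlib formalisation cell (harness21).  Prover seat hodgecm-mathlib-LH4-p05 (g2): Track A «(D-RAM) FOUR-FRAME» squad of crux H413
(dealer LH4-plan WORD #46 «p05 (g2) DEFAULT «=»: (ρ) ROW (3) … + the (ρ3b′) payer», brick F8 = the `h₀`-row of (ρ3b′)), 2026-09-04.
The PLACE-GENERIC LEVI H-VALUE OF THE INTEGRAL LEVEL `Φ_H(⟦(t,u)⟧, 1_{K_H}) = ν_H(K_H)·J_H(t)` at a non-split place, in the ★ H-descent (`skewModulus`) token —
the `χ₀ ↦ 1_{K_H}`, `|2|`- and ramification-FREE twin of ★ p846823 `classOrbitalIntegral_chiZero_eq_of_torus_deep_ramified` ∕ ★ p846841 `stableOrbitalIntegralRel_chiZero_eq_of_levi_frame_ramified`.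
-/
import Literature.NumberTheory.Rogawski1990.DepthZeroTransferHValuesLeviFrameRamified   -- ★ p846841: ★ H-descent (`classOrbitalIntegral_prod_eq_smul_integral_prod_of_torus_regular_of_nonsplit`), ★ `torus_mem_cmLocalIntegralLevel_of_deep`, ★ Levi kit, ★ one-class socket
import HarnessLib

/-!
# The LEVI H-value of the integral level, `Φ_H(⟦(t, u)⟧, 1_{K_H}) = ν_H(K_H) · J_H(t)`, and its `Φ^st` row, at a non-split place
(Rogawski 1990 §4.9 Prop. 4.9.1 (b), §4.3 (4.3.1); Kottwitz 1986 §1)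

Topic `NumberTheory/Rogawski1990`; namespace `Literature.NumberTheory.Automorphic.UnitaryGroup` (as the ★ tame heads p846823 ∕ p846841 and the ★ modular heads p855329 ∕ p855941).
THEOREMS ONLY (no definition, no instance, no notation, no named fact, no `sorry`).  Cell `pub/hodgecm-mathlib`, crux H413 = `stmt-HodgeConjecture-24833` (count-neutral),
Track A «(D-RAM) FOUR-FRAME», unit U2H, (ρ) ROW (3): LH4-p06 (g2)'s child **(ρ3b′) `stub_U2H_hProfiles_levi_ratio_wild`** compares, on the Levi population near `1 ∈ H_v`, the
`Φ^st`-values of the two vertex-type profiles `h₀ = hProfileZero = 1_{K_H}` and `h₁ = hProfileSharp = 1_{K♯ × U₁}` of ★ DEFS №5 `hFamily`.  The `h₁` rows are ★ p855329 §6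
(√π-type, value `ν_H(K_H)·J_H·(q+1)∕2`) and ★ p855941 §3 (√u-type, `ν_H(K_H)·J_H·2∕(q+1)`); THIS file is the `h₀` row **in the same `J_H` token** (the ★ H-descent's
`χ⁻(d₀⁻¹d₁ − 1)⁻¹`, `HeisRing.skewModulus`), so that the payer of (ρ3b′) can divide the two rows without a token bridge:
**`Φ^st(γ_H, 1_{K_H}) = ν_H(K_H)·J_H(γ_H)`** for every `G`-regular `γ_H` with a deep Levi witness — at ANY non-split place (no `e ≠ 1`, no `|2|_w = 1`, no anti-fixed element).

THE MATHEMATICS ([Rogawski1990] §4.9 p. 55 with the compatible measures (4.3.1); [Kottwitz1986BaseChangeUnits] §1).  ★ H-descent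
(`classOrbitalIntegral_prod_eq_smul_integral_prod_of_torus_regular_of_nonsplit`, Iwasawa through `K⁰ = U(Φ₂)(𝒪_v)`):
`Φ_H(⟦(t,u)⟧, φ) = (ν_H(K_H) ∕ (κ(K⁰)·μ_N(N₂ ∩ K⁰)))·J_H(t)·∫_{K⁰ × N₂} φ(k(tn)k⁻¹, u)`.  For `φ = 1_{K_H}` and a DEEP diagonal `t` (`t ∈ K⁰`, ★ `torus_mem_cmLocalIntegralLevel_of_deep`)
the integrand is `1[k(tn)k⁻¹ ∈ K⁰] = 1[n ∈ K⁰]` (`k ∈ K⁰`), so the integral is `κ(K⁰)·μ_N(N₂ ∩ K⁰)` and EVERYTHING CANCELS: **`Φ_H(⟦(t,u)⟧, 1_{K_H}) = ν_H(K_H)·J_H(t)`** (§1).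
§2 transports to the `Φ^st` currency at a `G`-regular Levi `γ_H` (one `H_v`-class per stable class on the Levi population, ★ `isConj_of_isLocalStablyConjH_of_levi` ∕
★ `stableOrbitalIntegralRel_eq_classOrbitalIntegral_of_unique`), binders = ★ p855329 §6 ∕ ★ p855941 §3 VERBATIM minus `(he) {θ∕α} (hθ∕hα) (hσθ∕hσα) (ϖ) (hϖ)`, same `J_H` token.
(The normalised-measure form `Φ_H = (√‖d₀⁻¹d₁ − 1‖)⁻¹` for `ν_H(K_H) = 1` is ★ C′₂ `classOrbitalIntegral_indicator_prod_eq_inv_sqrt_of_torus_regular_of_nonsplit`; this file does not use it.)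
* §1 **`classOrbitalIntegral_indicator_prod_eq_of_torus_deep_of_nonsplit`** (class-level HEAD);
* §2 **`stableOrbitalIntegralRel_indicator_prod_eq_of_levi_frame_of_nonsplit`** (the `Φ^st` Levi row of `1_{K_H}`).

HONEST LABEL: HC_CM is proved only modulo the 7 printed citations (2 remaining named inputs: hLiu418 = `stmt-HodgeConjecture-24832`, h413 = `stmt-HodgeConjecture-24833`) until
rung 0 closes; this file is unconditional, asserts nothing printed and freezes no stub text.

## References
* [Rogawski1990] J. D. Rogawski, *Automorphic Representations of Unitary Groups in Three Variables*, Ann. of Math. Stud. 123 (1990), §4.3 (4.3.1) p. 43; §4.9 p. 54–55, Prop. 4.9.1 (b).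
* [Kottwitz1986BaseChangeUnits] R. E. Kottwitz, *Base change for unit elements of Hecke algebras*, Compositio Math. 60 (1986), §1 pp. 240–241.
* [Tits1979] J. Tits, *Reductive groups over local fields*, PSPM 33.1 (1979), §3.7 (volumes of parahorics).
-/

set_option autoImplicit false

noncomputable section

open MeasureTheory Measure Set Filter Topology NumberField IsDedekindDomain Matrix Polynomial ValuativeRel
open scoped ENNReal NNReal ValuativeRel Matrix MatrixGroups

namespace Literature.NumberTheory.Automorphic.UnitaryGroup

open Literature.NumberTheory.Rogawski1990 Literature.NumberTheory.Automorphic Literature.NumberTheory.Automorphic.IntegralReduction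
open Literature.NumberTheory.Automorphic.UnitaryGroup.HeisRing Literature.NumberTheory.Automorphic.UnitaryGroup.LineRing

variable (L : Type) [Field L] [NumberField L] [IsCMField L] (v : HeightOneSpectrum (𝓞 ↥(maximalRealSubfield L)))
  (w : PlacesOver L v) (hw : IsCMField.complexConj L • w.1 = w.1)

/-! ## §1 HEAD: `Φ_H(⟦(t, u)⟧, 1_{K_H}) = ν_H(K_H) · J_H(t)` at a deep regular diagonal class, any non-split place -/

set_option maxHeartbeats 3200000 in
set_option synthInstance.maxHeartbeats 400000 in
-- instance-term unification on the CM local carriers (two spellings of `U(Φ₂)(L⁺_v)`), as in ★ p846823 ∕ ★ p855941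
include hw in
/-- **HEAD: `Φ_H(⟦(t, u)⟧, 1_{K₂ × K₁}) = ν_H(K₂ × K₁) · J_H(t)`** at a non-split place `w ∣ v`, for the indicator of the integral level `K_H = U(Φ₂)(𝒪_v) × U(Φ₁)(𝒪_v)`, at the class
of `(t, u)`, `t = diag(d₀, d₁) ∈ T₂(L⁺_v)` REGULAR (`d₀⁻¹d₁ − 1` a unit) and DEEP (`dᵢ ≡ 1 (mod 𝔪_w)`, so `t ∈ K⁰`), `u ∈ U(Φ₁)(L⁺_v) = K₁`; `m_H` CANONICAL for `(P_H, ν_H)`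
(`ν_H` ANY right-invariant Haar measure), `J_H(t) = χ⁻(d₀⁻¹d₁ − 1)⁻¹` the ★ H-descent token.  Proof: ★ H-descent with `φ = 1_{K_H}`; the Iwasawa integrand is `1[n ∈ K⁰]`
(`k, t ∈ K⁰`); `∫ = κ(K⁰)·μ_N(N₂ ∩ K⁰)` cancels against the descent's normalisation.  Binders = ★ p855941 `classOrbitalIntegral_chiSharp_eq_of_torus_deep_ramified_of_unit` VERBATIM
minus `(he) {α} (hα) (hσα) (ϖ) (hϖ)`. [cite: Rogawski1990, §4.9 Prop. 4.9.1 (b) p. 55; §4.3 (4.3.1) p. 43] [cite: Kottwitz1986BaseChangeUnits, §1 pp. 240–241] -/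
theorem classOrbitalIntegral_indicator_prod_eq_of_torus_deep_of_nonsplit
    [MeasurableSpace ((cmDatum L 2 (Matrix.of fun i j : Fin 2 => if i.val + j.val + 1 = 2 then (1 : L) else 0)).Local v × (cmDatum L 1 (Matrix.of fun i j : Fin 1 => if i.val + j.val + 1 = 1 then (1 : L) else 0)).Local v)] [BorelSpace ((cmDatum L 2 (Matrix.of fun i j : Fin 2 => if i.val + j.val + 1 = 2 then (1 : L) else 0)).Local v × (cmDatum L 1 (Matrix.of fun i j : Fin 1 => if i.val + j.val + 1 = 1 then (1 : L) else 0)).Local v)]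
    [∀ a : ((cmDatum L 2 (Matrix.of fun i j : Fin 2 => if i.val + j.val + 1 = 2 then (1 : L) else 0)).Local v × (cmDatum L 1 (Matrix.of fun i j : Fin 1 => if i.val + j.val + 1 = 1 then (1 : L) else 0)).Local v), MeasurableSpace (((cmDatum L 2 (Matrix.of fun i j : Fin 2 => if i.val + j.val + 1 = 2 then (1 : L) else 0)).Local v × (cmDatum L 1 (Matrix.of fun i j : Fin 1 => if i.val + j.val + 1 = 1 then (1 : L) else 0)).Local v) ⧸ Subgroup.centralizer ({a} : Set ((cmDatum L 2 (Matrix.of fun i j : Fin 2 => if i.val + j.val + 1 = 2 then (1 : L) else 0)).Local v × (cmDatum L 1 (Matrix.of fun i j : Fin 1 => if i.val + j.val + 1 = 1 then (1 : L) else 0)).Local v)))]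
    [∀ a : ((cmDatum L 2 (Matrix.of fun i j : Fin 2 => if i.val + j.val + 1 = 2 then (1 : L) else 0)).Local v × (cmDatum L 1 (Matrix.of fun i j : Fin 1 => if i.val + j.val + 1 = 1 then (1 : L) else 0)).Local v), BorelSpace (((cmDatum L 2 (Matrix.of fun i j : Fin 2 => if i.val + j.val + 1 = 2 then (1 : L) else 0)).Local v × (cmDatum L 1 (Matrix.of fun i j : Fin 1 => if i.val + j.val + 1 = 1 then (1 : L) else 0)).Local v) ⧸ Subgroup.centralizer ({a} : Set ((cmDatum L 2 (Matrix.of fun i j : Fin 2 => if i.val + j.val + 1 = 2 then (1 : L) else 0)).Local v × (cmDatum L 1 (Matrix.of fun i j : Fin 1 => if i.val + j.val + 1 = 1 then (1 : L) else 0)).Local v)))]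
    (νH : Measure ((cmDatum L 2 (Matrix.of fun i j : Fin 2 => if i.val + j.val + 1 = 2 then (1 : L) else 0)).Local v × (cmDatum L 1 (Matrix.of fun i j : Fin 1 => if i.val + j.val + 1 = 1 then (1 : L) else 0)).Local v)) [νH.IsHaarMeasure] [νH.IsMulRightInvariant]
    {P_H : ((cmDatum L 2 (Matrix.of fun i j : Fin 2 => if i.val + j.val + 1 = 2 then (1 : L) else 0)).Local v × (cmDatum L 1 (Matrix.of fun i j : Fin 1 => if i.val + j.val + 1 = 1 then (1 : L) else 0)).Local v) → Prop} {mH : OrbitalMeasureFamily ((cmDatum L 2 (Matrix.of fun i j : Fin 2 => if i.val + j.val + 1 = 2 then (1 : L) else 0)).Local v × (cmDatum L 1 (Matrix.of fun i j : Fin 1 => if i.val + j.val + 1 = 1 then (1 : L) else 0)).Local v)} (hmH : mH.IsCanonical P_H νH)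
    (t : ↥(cmBorelTriple L 2 v).M) {d : Fin 2 → (LocalRing L v)ˣ}
    (hd : glDiagonal 2 (LocalRing L v) d = ((t : ↥(unitaryGroupOfForm (conjLocal L (IsCMField.complexConj L) v) (cmLocalForm L 2 v))) : GL (Fin 2) (LocalRing L v)))
    (hb : IsUnit ((((d 0)⁻¹ * d 1 : (LocalRing L v)ˣ) : (LocalRing L v)) - 1))
    (hreg₂ : IsRegularElt ((t : ↥(unitaryGroupOfForm (conjLocal L (IsCMField.complexConj L) v) (cmLocalForm L 2 v))) : GL (Fin 2) (LocalRing L v)))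
    (ht1 : ∀ i : Fin 2, Valued.v ((((d i : (LocalRing L v)ˣ) : (LocalRing L v)) w) - 1) < 1)
    (u : (cmDatum L 1 (Matrix.of fun i j : Fin 1 => if i.val + j.val + 1 = 1 then (1 : L) else 0)).Local v) (hPH : P_H (Quotient.out (ConjClasses.mk (((t : ↥(unitaryGroupOfForm (conjLocal L (IsCMField.complexConj L) v) (cmLocalForm L 2 v))) : (cmDatum L 2 (Matrix.of fun i j : Fin 2 => if i.val + j.val + 1 = 2 then (1 : L) else 0)).Local v), u))))
    (hK₁ : ∀ x : (cmDatum L 1 (Matrix.of fun i j : Fin 1 => if i.val + j.val + 1 = 1 then (1 : L) else 0)).Local v, x ∈ cmLocalIntegralLevel L 1 (Matrix.of fun i j : Fin 1 => if i.val + j.val + 1 = 1 then (1 : L) else 0) v) :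
    classOrbitalIntegral mH (Set.indicator (((cmLocalIntegralLevel L 2 (Matrix.of fun i j : Fin 2 => if i.val + j.val + 1 = 2 then (1 : L) else 0) v).prod (cmLocalIntegralLevel L 1 (Matrix.of fun i j : Fin 1 => if i.val + j.val + 1 = 1 then (1 : L) else 0) v) : Subgroup ((cmDatum L 2 (Matrix.of fun i j : Fin 2 => if i.val + j.val + 1 = 2 then (1 : L) else 0)).Local v × (cmDatum L 1 (Matrix.of fun i j : Fin 1 => if i.val + j.val + 1 = 1 then (1 : L) else 0)).Local v)) : Set ((cmDatum L 2 (Matrix.of fun i j : Fin 2 => if i.val + j.val + 1 = 2 then (1 : L) else 0)).Local v × (cmDatum L 1 (Matrix.of fun i j : Fin 1 => if i.val + j.val + 1 = 1 then (1 : L) else 0)).Local v)) (fun _ => (1 : ℂ)))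
        (ConjClasses.mk (((t : ↥(unitaryGroupOfForm (conjLocal L (IsCMField.complexConj L) v) (cmLocalForm L 2 v))) : (cmDatum L 2 (Matrix.of fun i j : Fin 2 => if i.val + j.val + 1 = 2 then (1 : L) else 0)).Local v), u)) =
      (νH.real (((cmLocalIntegralLevel L 2 (Matrix.of fun i j : Fin 2 => if i.val + j.val + 1 = 2 then (1 : L) else 0) v).prod (cmLocalIntegralLevel L 1 (Matrix.of fun i j : Fin 1 => if i.val + j.val + 1 = 1 then (1 : L) else 0) v) : Subgroup ((cmDatum L 2 (Matrix.of fun i j : Fin 2 => if i.val + j.val + 1 = 2 then (1 : L) else 0)).Local v × (cmDatum L 1 (Matrix.of fun i j : Fin 1 => if i.val + j.val + 1 = 1 then (1 : L) else 0)).Local v)) : Set ((cmDatum L 2 (Matrix.of fun i j : Fin 2 => if i.val + j.val + 1 = 2 then (1 : L) else 0)).Local v × (cmDatum L 1 (Matrix.of fun i j : Fin 1 => if i.val + j.val + 1 = 1 then (1 : L) else 0)).Local v)) : ℂ) *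
        (((letI : MeasurableSpace (LocalRing L v) := borel _; haveI : BorelSpace (LocalRing L v) := ⟨rfl⟩
          haveI : SecondCountableTopology (LocalRing L v) := secondCountableTopology_localRing (E := L) v
          ((skewModulus (conjLocal L (IsCMField.complexConj L) v) (continuous_conjLocal L (IsCMField.complexConj L) v) hb.unit
            (map_unit_torusScalar_sub_one_two (conjLocal L (IsCMField.complexConj L) v) (cmLocalForm_eq_over L 2 v)
              (⟨(t : ↥(unitaryGroupOfForm (conjLocal L (IsCMField.complexConj L) v) (cmLocalForm L 2 v))), t.2⟩ : ↥(torusU (conjLocal L (IsCMField.complexConj L) v) (cmLocalForm L 2 v))) hd hb))⁻¹ : ℝ≥0)) : ℝ≥0) : ℂ) := by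
  haveI : Algebra.IsQuadraticExtension ↥(maximalRealSubfield L) L := IsCMField.isQuadraticExtension L
  -- measurable structures and Haar measures on `U(Φ₂)(L⁺_v) ⊇ K⁰, N₂` (they cancel in the end), as in ★ p846823
  haveI : LocallyCompactSpace ↥(unitaryGroupOfForm (conjLocal L (IsCMField.complexConj L) v) (cmLocalForm L 2 v)) := locallyCompactSpace_local (IsCMField.complexConj L) 2 _ v
  haveI : SecondCountableTopology ↥(unitaryGroupOfForm (conjLocal L (IsCMField.complexConj L) v) (cmLocalForm L 2 v)) := secondCountableTopology_local (IsCMField.complexConj L) 2 _ v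
  letI mU : MeasurableSpace ↥(unitaryGroupOfForm (conjLocal L (IsCMField.complexConj L) v) (cmLocalForm L 2 v)) := borel _
  haveI : BorelSpace ↥(unitaryGroupOfForm (conjLocal L (IsCMField.complexConj L) v) (cmLocalForm L 2 v)) := ⟨rfl⟩
  obtain ⟨K₂, hK2⟩ : ∃ K : Subgroup ↥(unitaryGroupOfForm (conjLocal L (IsCMField.complexConj L) v) (cmLocalForm L 2 v)), K = cmLocalIntegralLevel L 2 (Matrix.of fun i j : Fin 2 => if i.val + j.val + 1 = 2 then (1 : L) else 0) v := ⟨_, rfl⟩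
  have hK2co : IsCompact (K₂ : Set ↥(unitaryGroupOfForm (conjLocal L (IsCMField.complexConj L) v) (cmLocalForm L 2 v))) ∧ IsOpen (K₂ : Set ↥(unitaryGroupOfForm (conjLocal L (IsCMField.complexConj L) v) (cmLocalForm L 2 v))) := by
    rw [hK2]; exact isCompact_isOpen_cmLocalIntegralLevel L 2 (Matrix.of fun i j : Fin 2 => if i.val + j.val + 1 = 2 then (1 : L) else 0) v
  haveI : LocallyCompactSpace ↥K₂ := hK2co.1.isClosed.isClosedEmbedding_subtypeVal.locallyCompactSpace
  haveI : CompactSpace ↥K₂ := isCompact_iff_compactSpace.1 hK2co.1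
  have hN₂ : IsClosed (((unipotentU (conjLocal L (IsCMField.complexConj L) v) (cmLocalForm L 2 v))) : Set ↥(unitaryGroupOfForm (conjLocal L (IsCMField.complexConj L) v) (cmLocalForm L 2 v))) := isClosed_unipotentU _ _
  haveI : LocallyCompactSpace ↥(cmBorelTriple L 2 v).N := hN₂.isClosedEmbedding_subtypeVal.locallyCompactSpace
  haveI : SecondCountableTopology ↥(cmBorelTriple L 2 v).N := TopologicalSpace.Subtype.secondCountableTopology _
  haveI : SigmaCompactSpace ↥(cmBorelTriple L 2 v).N := sigmaCompactSpace_of_locallyCompact_secondCountable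
  obtain ⟨κ₂, hκ₂⟩ : ∃ κ : Measure ↥K₂, κ = Measure.haar := ⟨_, rfl⟩
  haveI : κ₂.IsHaarMeasure := by rw [hκ₂]; infer_instance
  obtain ⟨μN₂, hμN₂⟩ : ∃ μ : Measure ↥(cmBorelTriple L 2 v).N, μ = Measure.haar := ⟨_, rfl⟩
  haveI : μN₂.IsHaarMeasure := by rw [hμN₂]; infer_instance
  haveI : SigmaFinite μN₂ := inferInstance
  -- `1_{K_H}` is measurable: `K_H` is compact, hence closed
  have hKHc := (isCompact_and_interior_nonempty_prod_cmLocalIntegralLevel L v).1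
  have hχ : Measurable (Set.indicator (((cmLocalIntegralLevel L 2 (Matrix.of fun i j : Fin 2 => if i.val + j.val + 1 = 2 then (1 : L) else 0) v).prod (cmLocalIntegralLevel L 1 (Matrix.of fun i j : Fin 1 => if i.val + j.val + 1 = 1 then (1 : L) else 0) v) : Subgroup ((cmDatum L 2 (Matrix.of fun i j : Fin 2 => if i.val + j.val + 1 = 2 then (1 : L) else 0)).Local v × (cmDatum L 1 (Matrix.of fun i j : Fin 1 => if i.val + j.val + 1 = 1 then (1 : L) else 0)).Local v)) : Set ((cmDatum L 2 (Matrix.of fun i j : Fin 2 => if i.val + j.val + 1 = 2 then (1 : L) else 0)).Local v × (cmDatum L 1 (Matrix.of fun i j : Fin 1 => if i.val + j.val + 1 = 1 then (1 : L) else 0)).Local v)) (fun _ => (1 : ℂ))) := measurable_const.indicator hKHc.isClosed.measurableSet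
  -- ★ H-descent
  rw [classOrbitalIntegral_prod_eq_smul_integral_prod_of_torus_regular_of_nonsplit L w hw νH hmH K₂ hK2 κ₂ μN₂ t hd hb hreg₂ u hPH hK₁ _ hχ]
  -- positivity ∕ finiteness of `κ(K⁰)` and `μ_N(N₂ ∩ K⁰)`
  have hκ0 : κ₂ Set.univ ≠ 0 := IsOpenPosMeasure.open_pos _ isOpen_univ Set.univ_nonempty
  have hκt : κ₂ Set.univ ≠ ∞ := (isCompact_univ.measure_lt_top (μ := κ₂)).ne
  have hA0 : μN₂ {n : ↥(cmBorelTriple L 2 v).N | (n : ↥(unitaryGroupOfForm (conjLocal L (IsCMField.complexConj L) v) (cmLocalForm L 2 v))) ∈ K₂} ≠ 0 :=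
    (hK2co.2.preimage continuous_subtype_val).measure_ne_zero μN₂
      ⟨1, by simp only [Set.mem_preimage, OneMemClass.coe_one, SetLike.mem_coe]; exact one_mem _⟩
  have hAt : μN₂ {n : ↥(cmBorelTriple L 2 v).N | (n : ↥(unitaryGroupOfForm (conjLocal L (IsCMField.complexConj L) v) (cmLocalForm L 2 v))) ∈ K₂} ≠ ∞ :=
    (hN₂.isClosedEmbedding_subtypeVal.isCompact_preimage hK2co.1).measure_lt_top.ne
  have hAm : MeasurableSet {n : ↥(cmBorelTriple L 2 v).N | (n : ↥(unitaryGroupOfForm (conjLocal L (IsCMField.complexConj L) v) (cmLocalForm L 2 v))) ∈ K₂} :=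
    (hK2co.2.preimage continuous_subtype_val).measurableSet
  -- `t ∈ K⁰` (deep), so the Iwasawa integrand is `1[n ∈ K⁰]`
  have htK : (t : ↥(unitaryGroupOfForm (conjLocal L (IsCMField.complexConj L) v) (cmLocalForm L 2 v))) ∈ K₂ := by
    rw [hK2]; exact torus_mem_cmLocalIntegralLevel_of_deep L v w hw t hd ht1
  have hint : (∫ p : ↥K₂ × ↥(cmBorelTriple L 2 v).N,
        (Set.indicator (((cmLocalIntegralLevel L 2 (Matrix.of fun i j : Fin 2 => if i.val + j.val + 1 = 2 then (1 : L) else 0) v).prod (cmLocalIntegralLevel L 1 (Matrix.of fun i j : Fin 1 => if i.val + j.val + 1 = 1 then (1 : L) else 0) v) : Subgroup ((cmDatum L 2 (Matrix.of fun i j : Fin 2 => if i.val + j.val + 1 = 2 then (1 : L) else 0)).Local v × (cmDatum L 1 (Matrix.of fun i j : Fin 1 => if i.val + j.val + 1 = 1 then (1 : L) else 0)).Local v)) : Set ((cmDatum L 2 (Matrix.of fun i j : Fin 2 => if i.val + j.val + 1 = 2 then (1 : L) else 0)).Local v × (cmDatum L 1 (Matrix.of fun i j : Fin 1 => if i.val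 + j.val + 1 = 1 then (1 : L) else 0)).Local v)) (fun _ => (1 : ℂ)))
          (((((p.1 : ↥(unitaryGroupOfForm (conjLocal L (IsCMField.complexConj L) v) (cmLocalForm L 2 v))) * ((t : ↥(unitaryGroupOfForm (conjLocal L (IsCMField.complexConj L) v) (cmLocalForm L 2 v))) * (p.2 : ↥(unitaryGroupOfForm (conjLocal L (IsCMField.complexConj L) v) (cmLocalForm L 2 v))))) * (p.1 : ↥(unitaryGroupOfForm (conjLocal L (IsCMField.complexConj L) v) (cmLocalForm L 2 v)))⁻¹ : ↥(unitaryGroupOfForm (conjLocal L (IsCMField.complexConj L) v) (cmLocalForm L 2 v))) : ((cmDatum L 2 (Matrix.of fun i j : Fin 2 => if i.val + j.val + 1 = 2 then (1 : L) else 0)).Local v)), u) ∂(κ₂.prod μN₂)) =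
      ∫ p : ↥K₂ × ↥(cmBorelTriple L 2 v).N, ({n : ↥(cmBorelTriple L 2 v).N | (n : ↥(unitaryGroupOfForm (conjLocal L (IsCMField.complexConj L) v) (cmLocalForm L 2 v))) ∈ K₂}).indicator (fun _ => (1 : ℂ)) p.2 ∂(κ₂.prod μN₂) := by
    congr 1
    funext p
    have hk : (p.1 : ↥(unitaryGroupOfForm (conjLocal L (IsCMField.complexConj L) v) (cmLocalForm L 2 v))) ∈ K₂ := p.1.2
    -- membership of `(x, u)` in `K_H` is membership of `x` in `K⁰` (`u ∈ K₁ = U(Φ₁)(L⁺_v)`)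
    have e1 : ∀ x : ↥(unitaryGroupOfForm (conjLocal L (IsCMField.complexConj L) v) (cmLocalForm L 2 v)), (((x : ↥(unitaryGroupOfForm (conjLocal L (IsCMField.complexConj L) v) (cmLocalForm L 2 v))) : ((cmDatum L 2 (Matrix.of fun i j : Fin 2 => if i.val + j.val + 1 = 2 then (1 : L) else 0)).Local v)), u) ∈ (((cmLocalIntegralLevel L 2 (Matrix.of fun i j : Fin 2 => if i.val + j.val + 1 = 2 then (1 : L) else 0) v).prod (cmLocalIntegralLevel L 1 (Matrix.of fun i j : Fin 1 => if i.val + j.val + 1 = 1 then (1 : L) else 0) v) : Subgroup ((cmDatum L 2 (Matrix.of fun i j : Fin 2 => if i.val + j.val + 1 = 2 then (1 : L) else 0)).Local v × (cmDatum L 1 (Matrix.of fun i j : Fin 1 => if i.val + j.val + 1 = 1 then (1 : L) else 0)).Local v)) : Set ((cmDatum L 2 (Matrix.of fun i j : Fin 2 => if i.val + j.val + 1 = 2 then (1 : L) else 0)).Local v × (cmDatum L 1 (Matrix.of fun i j : Fin 1 => if i.val + j.val + 1 = 1 then (1 : L) else 0)).Local v)) ↔ x ∈ K₂ := fun x =>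 by
      rw [hK2]
      exact ⟨fun h => (Subgroup.mem_prod.1 h).1, fun h => Subgroup.mem_prod.2 ⟨h, hK₁ u⟩⟩
    have hiff : (((((p.1 : ↥(unitaryGroupOfForm (conjLocal L (IsCMField.complexConj L) v) (cmLocalForm L 2 v))) * ((t : ↥(unitaryGroupOfForm (conjLocal L (IsCMField.complexConj L) v) (cmLocalForm L 2 v))) * (p.2 : ↥(unitaryGroupOfForm (conjLocal L (IsCMField.complexConj L) v) (cmLocalForm L 2 v))))) * (p.1 : ↥(unitaryGroupOfForm (conjLocal L (IsCMField.complexConj L) v) (cmLocalForm L 2 v)))⁻¹ : ↥(unitaryGroupOfForm (conjLocal L (IsCMField.complexConj L) v) (cmLocalForm L 2 v))) : ((cmDatum L 2 (Matrix.of fun i j : Fin 2 => if i.val + j.val + 1 = 2 then (1 : L) else 0)).Local v)), u) ∈ (((cmLocalIntegralLevel L 2 (Matrix.of fun i j : Fin 2 => if i.val + j.val + 1 = 2 then (1 : L) else 0) v).prod (cmLocalIntegralLevel L 1 (Matrix.of fun i j : Fin 1 => if i.val + j.val + 1 = 1 then (1 : L) else 0) v) : Subgroup ((cmDatum L 2 (Matrix.of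 fun i j : Fin 2 => if i.val + j.val + 1 = 2 then (1 : L) else 0)).Local v × (cmDatum L 1 (Matrix.of fun i j : Fin 1 => if i.val + j.val + 1 = 1 then (1 : L) else 0)).Local v)) : Set ((cmDatum L 2 (Matrix.of fun i j : Fin 2 => if i.val + j.val + 1 = 2 then (1 : L) else 0)).Local v × (cmDatum L 1 (Matrix.of fun i j : Fin 1 => if i.val + j.val + 1 = 1 then (1 : L) else 0)).Local v)) ↔ (p.2 : ↥(unitaryGroupOfForm (conjLocal L (IsCMField.complexConj L) v) (cmLocalForm L 2 v))) ∈ K₂ := by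
      rw [e1, Subgroup.mul_mem_cancel_right K₂ (inv_mem hk), Subgroup.mul_mem_cancel_left K₂ hk, Subgroup.mul_mem_cancel_left K₂ htK]
    by_cases hp : (p.2 : ↥(unitaryGroupOfForm (conjLocal L (IsCMField.complexConj L) v) (cmLocalForm L 2 v))) ∈ K₂
    · exact (Set.indicator_of_mem (hiff.2 hp) _).trans
        (Set.indicator_of_mem (show p.2 ∈ {n : ↥(cmBorelTriple L 2 v).N | (n : ↥(unitaryGroupOfForm (conjLocal L (IsCMField.complexConj L) v) (cmLocalForm L 2 v))) ∈ K₂} from hp) (fun _ => (1 : ℂ))).symm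
    · exact (Set.indicator_of_notMem (mt hiff.1 hp) _).trans
        (Set.indicator_of_notMem (show p.2 ∉ {n : ↥(cmBorelTriple L 2 v).N | (n : ↥(unitaryGroupOfForm (conjLocal L (IsCMField.complexConj L) v) (cmLocalForm L 2 v))) ∈ K₂} from hp) (fun _ => (1 : ℂ))).symm
  -- evaluate the Iwasawa integral: `κ(K⁰) · μ_N(N₂ ∩ K⁰)`
  rw [hint, integral_fun_snd, integral_indicator_const (1 : ℂ) hAm, smul_smul, smul_smul, Complex.real_smul, mul_one]
  -- cancel `κ(K⁰)` and `μ_N(N₂ ∩ K⁰)` (both positive and finite)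
  have hB : (((κ₂ Set.univ).toReal : ℝ) : ℂ) ≠ 0 := by exact_mod_cast ENNReal.toReal_ne_zero.2 ⟨hκ0, hκt⟩
  have hC : (((μN₂ {n : ↥(cmBorelTriple L 2 v).N | (n : ↥(unitaryGroupOfForm (conjLocal L (IsCMField.complexConj L) v) (cmLocalForm L 2 v))) ∈ K₂}).toReal : ℝ) : ℂ) ≠ 0 := by
    exact_mod_cast ENNReal.toReal_ne_zero.2 ⟨hA0, hAt⟩
  have hJ : (((letI : MeasurableSpace (LocalRing L v) := borel _; haveI : BorelSpace (LocalRing L v) := ⟨rfl⟩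
          haveI : SecondCountableTopology (LocalRing L v) := secondCountableTopology_localRing (E := L) v
          (skewModulus (conjLocal L (IsCMField.complexConj L) v) (continuous_conjLocal L (IsCMField.complexConj L) v) hb.unit
            (map_unit_torusScalar_sub_one_two (conjLocal L (IsCMField.complexConj L) v) (cmLocalForm_eq_over L 2 v)
              (⟨(t : ↥(unitaryGroupOfForm (conjLocal L (IsCMField.complexConj L) v) (cmLocalForm L 2 v))), t.2⟩ : ↥(torusU (conjLocal L (IsCMField.complexConj L) v) (cmLocalForm L 2 v))) hd hb)) : ℝ≥0) : ℝ) : ℂ) ≠ 0 := by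
    letI : MeasurableSpace (LocalRing L v) := borel _
    haveI : BorelSpace (LocalRing L v) := ⟨rfl⟩
    haveI : SecondCountableTopology (LocalRing L v) := secondCountableTopology_localRing (E := L) v
    exact_mod_cast (skewModulus_pos (conjLocal L (IsCMField.complexConj L) v) (continuous_conjLocal L (IsCMField.complexConj L) v) _ _).ne'
  simp only [measureReal_def, ENNReal.toReal_mul, ENNReal.toReal_div, ENNReal.coe_toReal]
  push_cast
  field_simp

/-! ## §2 The `Φ^st`-currency LEVI row of `1_{K_H}` at a non-split place: `Φ^st(γ_H, 1_{K_H}) = ν_H(K_H)·J_H` -/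

section Place

variable
    [MeasurableSpace ((cmDatum L 2 (Matrix.of fun i j : Fin 2 => if i.val + j.val + 1 = 2 then (1 : L) else 0)).Local v × (cmDatum L 1 (Matrix.of fun i j : Fin 1 => if i.val + j.val + 1 = 1 then (1 : L) else 0)).Local v)] [BorelSpace ((cmDatum L 2 (Matrix.of fun i j : Fin 2 => if i.val + j.val + 1 = 2 then (1 : L) else 0)).Local v × (cmDatum L 1 (Matrix.of fun i j : Fin 1 => if i.val + j.val + 1 = 1 then (1 : L) else 0)).Local v)]
    [∀ a : ((cmDatum L 2 (Matrix.of fun i j : Fin 2 => if i.val + j.val + 1 = 2 then (1 : L) else 0)).Local v × (cmDatum L 1 (Matrix.of fun i j : Fin 1 => if i.val + j.val + 1 = 1 then (1 : L) else 0)).Local v), MeasurableSpace (((cmDatum L 2 (Matrix.of fun i j : Fin 2 => if i.val + j.val + 1 = 2 then (1 : L) else 0)).Local v × (cmDatum L 1 (Matrix.of fun i j : Fin 1 => if i.val + j.val + 1 = 1 then (1 : L) else 0)).Local v) ⧸ Subgroup.centralizer ({a} : Set ((cmDatum L 2 (Matrix.of fun i j : Fin 2 => if i.val + j.val + 1 =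 2 then (1 : L) else 0)).Local v × (cmDatum L 1 (Matrix.of fun i j : Fin 1 => if i.val + j.val + 1 = 1 then (1 : L) else 0)).Local v)))]
    [∀ a : ((cmDatum L 2 (Matrix.of fun i j : Fin 2 => if i.val + j.val + 1 = 2 then (1 : L) else 0)).Local v × (cmDatum L 1 (Matrix.of fun i j : Fin 1 => if i.val + j.val + 1 = 1 then (1 : L) else 0)).Local v), BorelSpace (((cmDatum L 2 (Matrix.of fun i j : Fin 2 => if i.val + j.val + 1 = 2 then (1 : L) else 0)).Local v × (cmDatum L 1 (Matrix.of fun i j : Fin 1 => if i.val + j.val + 1 = 1 then (1 : L) else 0)).Local v) ⧸ Subgroup.centralizer ({a} : Set ((cmDatum L 2 (Matrix.of fun i j : Fin 2 => if i.val + j.val + 1 = 2 then (1 : L) else 0)).Local v × (cmDatum L 1 (Matrix.of fun i j : Fin 1 => if i.val + j.val + 1 = 1 then (1 : L) else 0)).Local v)))]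
    (νH : Measure ((cmDatum L 2 (Matrix.of fun i j : Fin 2 => if i.val + j.val + 1 = 2 then (1 : L) else 0)).Local v × (cmDatum L 1 (Matrix.of fun i j : Fin 1 => if i.val + j.val + 1 = 1 then (1 : L) else 0)).Local v)) [νH.IsHaarMeasure] [νH.IsMulRightInvariant]

set_option maxHeartbeats 1600000 in
set_option synthInstance.maxHeartbeats 400000 in
-- instance-term unification on the CM local carriers, as in ★ p846841
include hw in
/-- **LEVI ROW OF `1_{K_H}` AT A NON-SPLIT PLACE, DEPTH-FREE: `Φ^st(γ_H, 1_{K_H}) = ν_H(K_H)·J_H`** for a `G`-regular `γ_H` with a Levi witness `(yγ_Hy⁻¹)₁ = diag(d′)`, `|d′ᵢ,w − 1| < 1` —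
§1 transported to `Φ^st` at `γ_H` exactly as ★ p846841's `χ₀` row (one class in the stable class, ★ `isConj_of_isLocalStablyConjH_of_levi` ∕ ★ `…of_unique`), `J_H` token = ★ p846841's
(unit named by ★ `isUnit_levi_of_isLocalGRegular_of_nonsplit … .2.1`).  Binders = ★ p855329 §6 ∕ ★ p855941 §3 VERBATIM minus `(he) {θ∕α} (hθ∕hα) (hσθ∕hσα) (ϖ) (hϖ)` — the `h₀`
row beside their `h₁` rows, for LH4-p06 (g2)'s ED. 7 child (ρ3b′). [cite: Rogawski1990, §4.9 Prop. 4.9.1 (b) p. 55; §4.3 (4.3.1) p. 43] [cite: Kottwitz1986BaseChangeUnits, §1 pp. 240–241] -/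
theorem stableOrbitalIntegralRel_indicator_prod_eq_of_levi_frame_of_nonsplit
    {mH : OrbitalMeasureFamily ((cmDatum L 2 (Matrix.of fun i j : Fin 2 => if i.val + j.val + 1 = 2 then (1 : L) else 0)).Local v × (cmDatum L 1 (Matrix.of fun i j : Fin 1 => if i.val + j.val + 1 = 1 then (1 : L) else 0)).Local v)} (hmH : mH.IsCanonical (IsLocalGRegular L v) νH)
    {γH : ((cmDatum L 2 (Matrix.of fun i j : Fin 2 => if i.val + j.val + 1 = 2 then (1 : L) else 0)).Local v × (cmDatum L 1 (Matrix.of fun i j : Fin 1 => if i.val + j.val + 1 = 1 then (1 : L) else 0)).Local v)} (hreg : IsLocalGRegular L v γH)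
    (y : ((cmDatum L 2 (Matrix.of fun i j : Fin 2 => if i.val + j.val + 1 = 2 then (1 : L) else 0)).Local v × (cmDatum L 1 (Matrix.of fun i j : Fin 1 => if i.val + j.val + 1 = 1 then (1 : L) else 0)).Local v)) {d' : Fin 2 → (UnitaryGroup.LocalRing L v)ˣ}
    (hyd' : glDiagonal 2 (UnitaryGroup.LocalRing L v) d' = ((y * γH * y⁻¹).1.val : GL (Fin 2) (UnitaryGroup.LocalRing L v)))
    (ht1 : ∀ i : Fin 2, Valued.v ((((d' i : (UnitaryGroup.LocalRing L v)ˣ) : UnitaryGroup.LocalRing L v) w) - 1) < 1) :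
    stableOrbitalIntegralRel (IsLocalStablyConjH L v) mH (Set.indicator (((cmLocalIntegralLevel L 2 (Matrix.of fun i j : Fin 2 => if i.val + j.val + 1 = 2 then (1 : L) else 0) v).prod (cmLocalIntegralLevel L 1 (Matrix.of fun i j : Fin 1 => if i.val + j.val + 1 = 1 then (1 : L) else 0) v) : Subgroup ((cmDatum L 2 (Matrix.of fun i j : Fin 2 => if i.val + j.val + 1 = 2 then (1 : L) else 0)).Local v × (cmDatum L 1 (Matrix.of fun i j : Fin 1 => if i.val + j.val + 1 = 1 then (1 : L) else 0)).Local v)) : Set ((cmDatum L 2 (Matrix.of fun i j : Fin 2 => if i.val + j.val + 1 = 2 then (1 : L) else 0)).Local v × (cmDatum L 1 (Matrix.of fun i j : Fin 1 => if i.val + j.val + 1 = 1 then (1 : L) else 0)).Local v)) (fun _ => (1 : ℂ))) γH =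
      (νH.real (((cmLocalIntegralLevel L 2 (Matrix.of fun i j : Fin 2 => if i.val + j.val + 1 = 2 then (1 : L) else 0) v).prod (cmLocalIntegralLevel L 1 (Matrix.of fun i j : Fin 1 => if i.val + j.val + 1 = 1 then (1 : L) else 0) v) : Subgroup ((cmDatum L 2 (Matrix.of fun i j : Fin 2 => if i.val + j.val + 1 = 2 then (1 : L) else 0)).Local v × (cmDatum L 1 (Matrix.of fun i j : Fin 1 => if i.val + j.val + 1 = 1 then (1 : L) else 0)).Local v)) : Set ((cmDatum L 2 (Matrix.of fun i j : Fin 2 => if i.val + j.val + 1 = 2 then (1 : L) else 0)).Local v × (cmDatum L 1 (Matrix.of fun i j : Fin 1 => if i.val + j.val + 1 = 1 then (1 : L) else 0)).Local v)) : ℂ) *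
        (((letI : MeasurableSpace (UnitaryGroup.LocalRing L v) := borel _; haveI : BorelSpace (UnitaryGroup.LocalRing L v) := ⟨rfl⟩
          haveI : SecondCountableTopology (UnitaryGroup.LocalRing L v) := secondCountableTopology_localRing (E := L) v
          ((HeisRing.skewModulus (conjLocal L (IsCMField.complexConj L) v) (continuous_conjLocal L (IsCMField.complexConj L) v) (((isUnit_levi_of_isLocalGRegular_of_nonsplit L w hw hyd' ((isLocalGRegular_conj_iff L y γH).2 hreg)).2.1)).unit
            (map_unit_torusScalar_sub_one_two (conjLocal L (IsCMField.complexConj L) v) (cmLocalForm_eq_over L 2 v)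
              (⟨(((y * γH * y⁻¹).1 : (cmDatum L 2 (Matrix.of fun i j : Fin 2 => if i.val + j.val + 1 = 2 then (1 : L) else 0)).Local v) : ↥(unitaryGroupOfForm (conjLocal L (IsCMField.complexConj L) v) (cmLocalForm L 2 v))), ⟨d', hyd'⟩⟩ : ↥(torusU (conjLocal L (IsCMField.complexConj L) v) (cmLocalForm L 2 v))) hyd' (((isUnit_levi_of_isLocalGRegular_of_nonsplit L w hw hyd' ((isLocalGRegular_conj_iff L y γH).2 hreg)).2.1))))⁻¹ : ℝ≥0)) : ℝ≥0) : ℂ) := by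
  haveI : Algebra.IsQuadraticExtension ↥(maximalRealSubfield L) L := IsCMField.isQuadraticExtension L
  -- the Levi representative `γ₁ := y γ_H y⁻¹ = (diag(d′), u₁)`: `G`-regular, twist scalar a unit, `U(Φ₂)`-part regular
  have hconj : IsConj γH (y * γH * y⁻¹) := isConj_iff.2 ⟨y, rfl⟩
  have hreg₁ : IsLocalGRegular L v (y * γH * y⁻¹) := (isLocalGRegular_conj_iff L y γH).2 hreg
  have hb := (isUnit_levi_of_isLocalGRegular_of_nonsplit L w hw hyd' hreg₁).2.1
  have h3 : IsRegularElt ((endoEmbLocal L v (y * γH * y⁻¹)).val : GL (Fin 3) (UnitaryGroup.LocalRing L v)) := hreg₁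
  rw [isRegularElt_iff, coe_endoEmbLocal, charpoly_endoGL] at h3
  have hreg₂ : IsRegularElt ((y * γH * y⁻¹).1.val : GL (Fin 2) (UnitaryGroup.LocalRing L v)) := h3.of_mul_left
  have hK₁ : ∀ x : (cmDatum L 1 (Matrix.of fun i j : Fin 1 => if i.val + j.val + 1 = 1 then (1 : L) else 0)).Local v, x ∈ cmLocalIntegralLevel L 1 (Matrix.of fun i j : Fin 1 => if i.val + j.val + 1 = 1 then (1 : L) else 0) v := fun x => by
    rw [cmLocalIntegralLevel_one_eq_top_of_smul_eq L _ w hw (isUnit_placeForm_antidiagOne (E := L) 1 w.1)]; exact Subgroup.mem_top x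
  -- one `H_v`-class in the stable class of `γ_H`
  have h01 : IsUnit (((d' 0 : (UnitaryGroup.LocalRing L v)ˣ) : UnitaryGroup.LocalRing L v) - d' 1) := by
    have key : ((d' 0 : (UnitaryGroup.LocalRing L v)ˣ) : UnitaryGroup.LocalRing L v) * ((((d' 0)⁻¹ * d' 1 : (UnitaryGroup.LocalRing L v)ˣ) : UnitaryGroup.LocalRing L v) - 1) = ((d' 1 : (UnitaryGroup.LocalRing L v)ˣ) : UnitaryGroup.LocalRing L v) - (d' 0 : (UnitaryGroup.LocalRing L v)ˣ) := by
      rw [mul_sub, mul_one, Units.val_mul, ← mul_assoc, Units.mul_inv, one_mul]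
    have h := (d' 0).isUnit.mul hb
    rw [key, ← neg_sub] at h
    exact (IsUnit.neg_iff _).1 h
  have huniq : ∀ k : ((cmDatum L 2 (Matrix.of fun i j : Fin 2 => if i.val + j.val + 1 = 2 then (1 : L) else 0)).Local v × (cmDatum L 1 (Matrix.of fun i j : Fin 1 => if i.val + j.val + 1 = 1 then (1 : L) else 0)).Local v), IsLocalStablyConjH L v γH k → IsConj γH k := fun k hk =>
    hconj.trans (isConj_of_isLocalStablyConjH_of_levi L hyd' h01
      (IsStablyConjH.trans ((isLocalStablyConjH_of_isConj_and_conj L (y * γH * y⁻¹)).1 _ hconj.symm) hk))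
  rw [stableOrbitalIntegralRel_eq_classOrbitalIntegral_of_unique (IsLocalStablyConjH L v) mH _ γH (isLocalStablyConjH_of_isConj_and_conj L γH).1 huniq,
    ConjClasses.mk_eq_mk_iff_isConj.2 hconj]
  exact classOrbitalIntegral_indicator_prod_eq_of_torus_deep_of_nonsplit L v w hw νH hmH
    (⟨(y * γH * y⁻¹).1, ⟨d', hyd'⟩⟩ : ↥(cmBorelTriple L 2 v).M) hyd' hb hreg₂ ht1 (y * γH * y⁻¹).2 (isLocalGRegular_out_mk hreg₁) hK₁

end Place

end Literature.NumberTheory.Automorphic.UnitaryGroup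

end
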